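import Literature.Topology.FourManifolds.TrisectionsMorseTransport
import Literature.Topology.FourManifolds.SPC4HandleChainProofs
import Mathlib.Geometry.Manifold.PartitionOfUnity
import Mathlib.Analysis.Calculus.MeanValue
import Mathlib.Analysis.Calculus.LineDeriv.Basic
import Mathlib.Analysis.Calculus.LocalExtr.Basic
import Mathlib.Analysis.SpecialFunctions.SmoothTransition
import Mathlib.Topology.Separation.Regular
import HarnessLib

/-!
# Lemmas for the ambient Morse function of a re-structured sector

Topic `Literature/Topology/FourManifolds`; infrastructure for the fact seat
`provefact-Literature.Topology.FourManifolds.exists-14560f9fc8` (named fact (c′)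
`Literature.Topology.FourManifolds.exists_stabilized_gkTrisection`), continuing
`TrisectionsMorseTransport.lean`.  Everything in this file is **proved**; no definitions,
no named facts.

Towards an *ambient* Morse function presenting the handle decomposition of a sector `S i`
re-structured by its corner-slice atlas (`IsGKTrisection.exists_cornerSliceAtlas`,
`CornerSliceAtlas.hasHandleDecomposition_of_comp_val`): the sector Morse function `f` of
clause (ii) is extended off a neighbourhood of the central surface and then interpolated, near
the central surface, with the corner model `1 - 2uv · K`.  This file collects the pieces that
do not involve the cornered Hadamard lemma:

* `exists_contMDiff_extension_off` — a smooth `F : X → ℝ` with `F (e w) = f w` whenever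
  `e w` lies outside a given neighbourhood `V` of the central surface (local extensions at the
  immersion points, `exists_contMDiffOn_extension_of_isImmersionAt`, glued by Mathlib's
  `exists_contMDiffMap_forall_mem_convex_of_local`);
* `hasDerivAt_interp_line_neg` — **the interpolated corner function
  `1 - 2 q₀ q₁ [(1 - χ₁(r²/η)) K̂ + χ₁(r²/η) K̂ ∘ stratumProj]` has negative `u`-derivative** at
  the points `q₀ ≥ 0 < q₁`, `r² ≤ η` of a ball around a stratum point on which `K̂ ≥ m > 0`,
  `‖dK̂‖ ≤ C`, as soon as `√η · C (1 + 2C_χ) < m` (the estimate that rules out critical points in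
  the transition region); `fderiv_ne_zero_of_eventuallyEq_line` — a one-sided line derivative
  determines `dĜ ≠ 0` (for the face points);
* `cutoffProfile_props`, `exists_localised_cutoff` — the cutoff profile
  `χ₁ x = smoothTransition (2 - 2x)` and the cutoff `χ₁((u² + v²)/η)` localised near the
  central surface (extended by `0`, smooth for `η` small);
* `apply_mem_interior_range_of_isInteriorPoint`, `apply_lt_one_of_mem_interior_range`,
  `HalfSliceChart.apply_zero_pos_iff_mem_interior` — interior points of `W`, points of the
  sector interior to it in `X`, points with `f < 1`, and positive half-slice coordinate all
  agree (off the central surface).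

## References

* J. Milnor, *Lectures on the h-cobordism theorem* (1965), Def. 3.1 (Morse functions on
  manifolds with boundary) and §3. [MilnorHCobordism1965]
* R. T. Seeley, *Extension of `C^∞` functions defined in a half space*, Proc. Amer. Math.
  Soc. 15 (1964), 625–626. [Seeley1964]
* J. M. Lee, *Introduction to Smooth Manifolds*, 2nd ed. (2013), Lemma 2.26 (extension lemma
  for smooth functions). [LeeSmoothManifolds2013]
-/

open scoped Manifold ContDiff Topology
open Set Function Filter

noncomputable section

namespace Literature.Topology.FourManifolds

universe u

section Extension

variable {X : Type u} [TopologicalSpace X] [T2Space X] [CompactSpace X]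
  [ChartedSpace (EuclideanSpace ℝ (Fin 4)) X] [IsManifold (𝓡 4) ∞ X]
  {W : Type u} [TopologicalSpace W] [ChartedSpace (EuclideanHalfSpace 4) W]

/-- **Extending the Morse function of a sector ambiently, off a neighbourhood of the central
surface.**  Let `e : W → X` be a topological embedding with closed image which is an immersion
at every point not over the set `K`, `f : W → ℝ` smooth, and `V ⊇ K` open.  Then some smooth
`F : X → ℝ` satisfies `F (e w) = f w` whenever `e w ∉ V` (local extensions at the immersion
points, `exists_contMDiffOn_extension_of_isImmersionAt`, glued with the unconstrained open set
`X ∖ (e(W) ∖ V)` by a smooth partition of unity: Mathlib's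
`exists_contMDiffMap_forall_mem_convex_of_local` with the convex constraint
`F y ∈ {f (e⁻¹ y)}` on `e(W) ∖ V`).
[cite: Seeley1964, Theorem; LeeSmoothManifolds2013, Lemma 2.26] -/
theorem exists_contMDiff_extension_off {e : W → X} (he : Topology.IsEmbedding e)
    (hclosed : IsClosed (range e)) {K : Set X}
    (himm : ∀ w, e w ∉ K → Manifold.IsImmersionAt (𝓡∂ 4) (𝓡 4) ∞ e w)
    {f : W → ℝ} (hf : ContMDiff (𝓡∂ 4) 𝓘(ℝ, ℝ) ∞ f) {V : Set X} (hV : IsOpen V) (hKV : K ⊆ V) :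
    ∃ F : X → ℝ, ContMDiff (𝓡 4) 𝓘(ℝ, ℝ) ∞ F ∧ ∀ w, e w ∉ V → F (e w) = f w := by
  -- the constraint: on `e(W) ∖ V`, the value `f (e⁻¹ y)`
  set t : X → Set ℝ := fun y => {r | y ∈ range e \ V → ∀ w, e w = y → r = f w} with ht
  have hconv : ∀ y, Convex ℝ (t y) := by
    intro y
    by_cases hy : y ∈ range e \ V
    · obtain ⟨w, rfl⟩ := hy.1
      have : t (e w) = {f w} := by
        ext r
        simp only [ht, mem_setOf_eq, mem_singleton_iff]
        constructor
        · intro h; exact h hy w rfl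
        · rintro rfl - w' hw'; rw [he.injective hw']
      rw [this]; exact convex_singleton _
    · have : t y = univ := by
        ext r; simp only [ht, mem_setOf_eq, mem_univ, iff_true]; exact fun h => absurd h hy
      rw [this]; exact convex_univ
  obtain ⟨g, hg⟩ : ∃ g : C^∞⟮𝓡 4, X; 𝓘(ℝ, ℝ), ℝ⟯, ∀ y, g y ∈ t y := by
    refine exists_contMDiffMap_forall_mem_convex_of_local (I := 𝓡 4) hconv fun y₀ => ?_
    by_cases hy₀ : y₀ ∈ range e \ V
    · obtain ⟨w₀, hw₀⟩ := hy₀.1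
      have hK : e w₀ ∉ K := fun h => hy₀.2 (hw₀ ▸ hKV h)
      obtain ⟨N, F₁, hNo, hwN, hF₁s, hF₁f⟩ :=
        exists_contMDiffOn_extension_of_isImmersionAt he (himm w₀ hK) hf
      refine ⟨N, hNo.mem_nhds (hw₀ ▸ hwN), F₁, hF₁s, fun y hy hyV w hw => ?_⟩
      rw [← hw]; exact hF₁f w (hw ▸ hy)
    · have hopen : IsOpen (range e \ V)ᶜ := (hclosed.sdiff hV).isOpen_compl
      exact ⟨(range e \ V)ᶜ, hopen.mem_nhds hy₀, fun _ => 0, contMDiffOn_const,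
        fun y hy hyV => absurd hyV hy⟩
  refine ⟨g, g.contMDiff, fun w hw => ?_⟩
  exact hg (e w) ⟨mem_range_self w, hw⟩ w rfl

end Extension

section Interp

/-- `‖stratumProj q - q‖² = q₀² + q₁²`. [folklore] -/
theorem norm_stratumProj_sub_sq (q : EuclideanSpace ℝ (Fin 4)) :
    ‖stratumProj q - q‖ ^ 2 = q 0 ^ 2 + q 1 ^ 2 := by
  rw [EuclideanSpace.norm_eq, Real.sq_sqrt (Finset.sum_nonneg fun _ _ => by positivity)]
  simp [Fin.sum_univ_four, stratumProj, sq_abs]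

/-- Projecting to the stratum does not increase the distance to a stratum point. [folklore] -/
theorem norm_stratumProj_sub_le {q qm : EuclideanSpace ℝ (Fin 4)} (h0 : qm 0 = 0) (h1 : qm 1 = 0) :
    ‖stratumProj q - qm‖ ≤ ‖q - qm‖ := by
  rw [EuclideanSpace.norm_eq, EuclideanSpace.norm_eq]
  refine Real.sqrt_le_sqrt ?_
  simp only [Fin.sum_univ_four, Real.norm_eq_abs, sq_abs, PiLp.sub_apply, stratumProj_apply_zero,
    stratumProj_apply_one, stratumProj_apply_two, stratumProj_apply_three, h0, h1, sub_zero]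
  nlinarith [sq_nonneg (q 0), sq_nonneg (q 1)]

/-- **The interpolated corner function has negative `u`-derivative at interior points close to
the corner (chart estimate).**  For
`Ĝ(z) = 1 - 2 z₀ z₁ [(1 - χ₁(r²/η)) K̂(z) + χ₁(r²/η) K̂(stratumProj z)]`, `r² = z₀² + z₁²`, with
`K̂ ≥ m > 0` and `‖dK̂‖ ≤ C` on a ball around a stratum point, `0 ≤ χ₁ ≤ 1`, `|χ₁'| ≤ C_χ`: at a
point `q` of the ball with `q₀ ≥ 0`, `q₁ > 0`, `r² ≤ η` and `√η · C (1 + 2 C_χ) < m`, the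
derivative of
`Ĝ` along the line `s ↦ q + s e₀` (written with `(q + s e₀)₀ = q₀ + s`, `(q + s e₀)₁ = q₁`,
`stratumProj (q + s e₀) = stratumProj q`) at `s = 0` is `-2 q₁ (M + q₀ D)` with `M ≥ m` and
`|q₀ D| ≤ √η C (1 + 2C_χ) < m`, hence **negative**. [folklore] -/
theorem hasDerivAt_interp_line_neg {Kh : EuclideanSpace ℝ (Fin 4) → ℝ} {χ₁ : ℝ → ℝ}
    {η m C Cχ R : ℝ} {qm q : EuclideanSpace ℝ (Fin 4)}
    (hKd : ∀ z ∈ Metric.ball qm R, DifferentiableAt ℝ Kh z)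
    (hKC : ∀ z ∈ Metric.ball qm R, ‖fderiv ℝ Kh z‖ ≤ C)
    (hKm : ∀ z ∈ Metric.ball qm R, m ≤ Kh z) (hC : 0 ≤ C)
    (hχd : Differentiable ℝ χ₁) (hχC : ∀ x, |deriv χ₁ x| ≤ Cχ) (hχ01 : ∀ x, 0 ≤ χ₁ x ∧ χ₁ x ≤ 1)
    (hCχ : 0 ≤ Cχ) (hqm : qm 0 = 0 ∧ qm 1 = 0) (hq : q ∈ Metric.ball qm R) (hq0 : 0 ≤ q 0)
    (hq1 : 0 < q 1) (hη : 0 < η) (hqη : q 0 ^ 2 + q 1 ^ 2 ≤ η)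
    (hsmall : Real.sqrt η * (C * (1 + 2 * Cχ)) < m) :
    ∃ g' : ℝ, g' < 0 ∧ HasDerivAt (fun s : ℝ =>
      1 - 2 * (q 0 + s) * q 1 *
        ((1 - χ₁ (((q 0 + s) ^ 2 + q 1 ^ 2) / η)) * Kh (q + s • EuclideanSpace.single 0 (1:ℝ)) +
          χ₁ (((q 0 + s) ^ 2 + q 1 ^ 2) / η) * Kh (stratumProj q))) g' 0 := by
  set e0 : EuclideanSpace ℝ (Fin 4) := EuclideanSpace.single 0 (1:ℝ) with he0
  set kc : ℝ := Kh (stratumProj q) with hkc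
  set ρ : ℝ → ℝ := fun s => ((q 0 + s) ^ 2 + q 1 ^ 2) / η with hρ
  -- derivatives of the pieces at `0`
  have hρd : HasDerivAt ρ (2 * q 0 / η) 0 := by
    have h1 : HasDerivAt (fun s : ℝ => (q 0 + s) ^ 2 + q 1 ^ 2) (2 * q 0) 0 := by
      have := ((hasDerivAt_id (0:ℝ)).const_add (q 0)).pow 2
      simpa using this.add_const (q 1 ^ 2)
    have := h1.div_const η
    simpa [hρ] using this
  have hρ0 : ρ 0 = (q 0 ^ 2 + q 1 ^ 2) / η := by simp [hρ]
  set χ0 : ℝ := χ₁ (ρ 0) with hχ0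
  set χ' : ℝ := deriv χ₁ (ρ 0) with hχ'
  have hχsd : HasDerivAt (fun s => χ₁ (ρ s)) (χ' * (2 * q 0 / η)) 0 :=
    (hχd (ρ 0)).hasDerivAt.comp 0 hρd
  set dK : ℝ := fderiv ℝ Kh q e0 with hdK
  have hKline : HasDerivAt (fun s : ℝ => Kh (q + s • e0)) dK 0 := by
    have h := (hKd q hq).hasFDerivAt.hasLineDerivAt e0
    unfold HasLineDerivAt at h
    exact h
  -- the bracket and its derivative
  set M : ℝ := (1 - χ0) * Kh q + χ0 * kc with hM
  set D : ℝ := (1 - χ0) * dK + χ' * (2 * q 0 / η) * (kc - Kh q) with hD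
  have hBd : HasDerivAt (fun s => (1 - χ₁ (ρ s)) * Kh (q + s • e0) + χ₁ (ρ s) * kc) D 0 := by
    have h1 := ((hasDerivAt_const (0:ℝ) (1:ℝ)).sub hχsd).mul hKline
    have h2 := hχsd.mul_const kc
    have h := h1.add h2
    refine h.congr_deriv ?_
    simp only [hD, hχ0, hχ', Pi.sub_apply, zero_smul, add_zero]
    ring
  -- the whole line function
  have hgd : HasDerivAt (fun s : ℝ => 1 - 2 * (q 0 + s) * q 1 *
      ((1 - χ₁ (ρ s)) * Kh (q + s • e0) + χ₁ (ρ s) * kc)) (-(2 * q 1 * (M + q 0 * D))) 0 := by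
    have h1 : HasDerivAt (fun s : ℝ => 2 * (q 0 + s) * q 1) (2 * q 1) 0 := by
      have := (((hasDerivAt_id (0:ℝ)).const_add (q 0)).const_mul 2).mul_const (q 1)
      simpa using this
    have h := (hasDerivAt_const (0:ℝ) (1:ℝ)).sub (h1.mul hBd)
    refine h.congr_deriv ?_
    simp only [hM, hχ0, add_zero, zero_smul]
    ring
  -- ### the estimate
  have hr : Real.sqrt (q 0 ^ 2 + q 1 ^ 2) ≤ Real.sqrt η := Real.sqrt_le_sqrt hqη
  have hq0le : q 0 ≤ Real.sqrt η := by
    have h1 : q 0 = Real.sqrt (q 0 ^ 2) := by rw [Real.sqrt_sq hq0]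
    have h2 : Real.sqrt (q 0 ^ 2) ≤ Real.sqrt (q 0 ^ 2 + q 1 ^ 2) :=
      Real.sqrt_le_sqrt (by nlinarith)
    linarith [h2.trans hr]
  have hq0sq : q 0 ^ 2 ≤ η := by nlinarith
  -- `|dK| ≤ C`
  have hdKle : |dK| ≤ C := by
    have h := (fderiv ℝ Kh q).le_opNorm e0
    have hn : ‖e0‖ = 1 := by
      rw [he0, EuclideanSpace.norm_eq]; simp
    rw [hn, mul_one] at h
    rw [hdK, ← Real.norm_eq_abs]
    exact h.trans (hKC q hq)
  -- `|kc - K̂ q| ≤ C √η`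
  have hsPmem : stratumProj q ∈ Metric.ball qm R := by
    rw [Metric.mem_ball, dist_eq_norm] at hq ⊢
    exact (norm_stratumProj_sub_le hqm.1 hqm.2).trans_lt hq
  have hkcle : |kc - Kh q| ≤ C * Real.sqrt η := by
    have hmvt := (convex_ball qm R).norm_image_sub_le_of_norm_fderiv_le (𝕜 := ℝ) (f := Kh)
      (fun z hz => hKd z hz) (fun z hz => hKC z hz) hq hsPmem
    rw [Real.norm_eq_abs] at hmvt
    have hnorm : ‖stratumProj q - q‖ = Real.sqrt (q 0 ^ 2 + q 1 ^ 2) := by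
      rw [← norm_stratumProj_sub_sq, Real.sqrt_sq (norm_nonneg _)]
    rw [hnorm] at hmvt
    exact hmvt.trans (mul_le_mul_of_nonneg_left hr hC)
  -- `|q₀ D| ≤ √η C (1 + 2 Cχ)`
  have hχ'le : |χ'| ≤ Cχ := hχC _
  have hχ0mem := hχ01 (ρ 0)
  have hD1 : |q 0 * ((1 - χ0) * dK)| ≤ Real.sqrt η * C := by
    rw [abs_mul, abs_mul, abs_of_nonneg hq0]
    have h1 : |1 - χ0| ≤ 1 := by
      rw [abs_le]; exact ⟨by linarith [hχ0mem.2], by linarith [hχ0mem.1]⟩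
    have h2 : |1 - χ0| * |dK| ≤ 1 * C := mul_le_mul h1 hdKle (abs_nonneg _) zero_le_one
    rw [one_mul] at h2
    exact mul_le_mul hq0le h2 (mul_nonneg (abs_nonneg _) (abs_nonneg _)) (Real.sqrt_nonneg _)
  have hD2 : |q 0 * (χ' * (2 * q 0 / η) * (kc - Kh q))| ≤ 2 * Cχ * C * Real.sqrt η := by
    rw [abs_mul, abs_mul, abs_mul, abs_of_nonneg hq0,
      abs_of_nonneg (show 0 ≤ 2 * q 0 / η by positivity)]
    have h1 : q 0 * (|χ'| * (2 * q 0 / η) * |kc - Kh q|) ≤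
        q 0 * (Cχ * (2 * q 0 / η) * (C * Real.sqrt η)) := by
      gcongr
    have h2 : q 0 * (Cχ * (2 * q 0 / η) * (C * Real.sqrt η)) =
        (q 0 ^ 2 / η) * (2 * Cχ * C * Real.sqrt η) := by
      ring
    have h3 : q 0 ^ 2 / η ≤ 1 := (div_le_one hη).2 hq0sq
    have h4 : (q 0 ^ 2 / η) * (2 * Cχ * C * Real.sqrt η) ≤ 1 * (2 * Cχ * C * Real.sqrt η) :=
      mul_le_mul_of_nonneg_right h3 (by positivity)
    linarith
  have hq0D : |q 0 * D| ≤ Real.sqrt η * (C * (1 + 2 * Cχ)) := by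
    have : q 0 * D = q 0 * ((1 - χ0) * dK) + q 0 * (χ' * (2 * q 0 / η) * (kc - Kh q)) := by
      rw [hD]; ring
    rw [this]
    refine (abs_add_le _ _).trans ?_
    nlinarith [hD1, hD2, Real.sqrt_nonneg η]
  -- `M ≥ m`
  have hMge : m ≤ M := by
    have h1 : m ≤ Kh q := hKm q hq
    have h2 : m ≤ kc := hKm _ hsPmem
    rw [hM]; nlinarith [hχ0mem.1, hχ0mem.2]
  have hpos : 0 < M + q 0 * D := by
    have := neg_abs_le (q 0 * D)
    linarith
  exact ⟨-(2 * q 1 * (M + q 0 * D)), by nlinarith [mul_pos hq1 hpos], hgd⟩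


/-- **From a one-sided line derivative to a nonzero derivative.**  If `Ĝ` is differentiable at
`q` and, along the half-line `s ↦ q + s v` (`s ≥ 0` small), agrees with a function `g` having
derivative `g' ≠ 0` at `0`, then `dĜ(q) ≠ 0` (the derivative within `[0, ∞)` is unique).
[folklore] -/
theorem fderiv_ne_zero_of_eventuallyEq_line {G : EuclideanSpace ℝ (Fin 4) → ℝ}
    {q v : EuclideanSpace ℝ (Fin 4)} (hG : DifferentiableAt ℝ G q) {g : ℝ → ℝ} {g' : ℝ}
    (hg : HasDerivAt g g' 0) (hg' : g' ≠ 0)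
    (heq : ∀ᶠ s in 𝓝[≥] (0:ℝ), G (q + s • v) = g s) : fderiv ℝ G q ≠ 0 := by
  intro hzero
  have hline : HasDerivAt (fun s : ℝ => G (q + s • v)) (fderiv ℝ G q v) 0 := by
    have h := hG.hasFDerivAt.hasLineDerivAt v
    unfold HasLineDerivAt at h
    exact h
  rw [hzero, zero_apply] at hline
  have h1 : HasDerivWithinAt (fun s : ℝ => G (q + s • v)) 0 (Ici 0) 0 := hline.hasDerivWithinAt
  have h2 : HasDerivWithinAt g g' (Ici 0) 0 := hg.hasDerivWithinAt
  have h3 : HasDerivWithinAt g 0 (Ici 0) 0 := by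
    refine h1.congr_of_eventuallyEq ?_ ?_
    · filter_upwards [heq] with s hs; exact hs.symm
    · have := heq.self_of_nhdsWithin (by simp : (0:ℝ) ∈ Ici 0)
      simpa using this.symm
  have huniq : g' = 0 := (uniqueDiffWithinAt_Ici 0).eq_deriv _ h2 h3
  exact hg' huniq

end Interp

section Boundary

variable {X : Type u} [TopologicalSpace X] [ChartedSpace (EuclideanSpace ℝ (Fin 4)) X]
  {W : Type u} [TopologicalSpace W] [ChartedSpace (EuclideanHalfSpace 4) W]

/-- **Interior points of the sector manifold go to interior points of the sector** (as a subset
of `X`): at an interior immersion point the charts of `exists_charts_of_isImmersionAt` show that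
`e` maps a neighbourhood onto a neighbourhood in `X` (invariance of the interior for charts of
the maximal atlas, `mem_interior_range_of_mem_maximalAtlas`). [folklore] -/
theorem apply_mem_interior_range_of_isInteriorPoint [IsManifold (𝓡∂ 4) ∞ W] {e : W → X}
    {w : W} (himm : Manifold.IsImmersionAt (𝓡∂ 4) (𝓡 4) ∞ e w)
    (hint : (𝓡∂ 4).IsInteriorPoint w) : e w ∈ interior (range e) := by
  obtain ⟨φ, ψ, Le, hφmem, hψmem, hwφ, hsrc, htgt, hkey, hΘe⟩ := exists_charts_of_isImmersionAt himm
  set V' : Set (EuclideanSpace ℝ (Fin 4)) := (𝓡∂ 4).symm ⁻¹' φ.target with hV'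
  have hV'o : IsOpen V' := φ.open_target.preimage (𝓡∂ 4).continuous_symm
  set z := φ.extend (𝓡∂ 4) w with hz
  have hzint : z ∈ interior (range (𝓡∂ 4)) := mem_interior_range_of_mem_maximalAtlas hφmem hwφ hint
  have hzV' : z ∈ V' := by have := (hΘe w hwφ).2; rw [htgt] at this; exact this.1
  -- an open set of `ℝ⁴` around `z` inside the target
  set B : Set (EuclideanSpace ℝ (Fin 4)) := V' ∩ interior (range (𝓡∂ 4)) with hB
  have hBo : IsOpen B := hV'o.inter isOpen_interior
  have hzB : z ∈ B := ⟨hzV', hzint⟩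
  have hBtgt : B ⊆ (φ.extend (𝓡∂ 4)).target := by
    intro x hx
    rw [htgt]
    refine ⟨hx.1, ?_⟩
    have := interior_subset hx.2
    rw [range_modelWithCornersEuclideanHalfSpace] at this
    exact this
  -- its preimage under `Le⁻¹ ∘ ψ` is an open set of `X` around `e w` inside `range e`
  set Θ₀ : X → EuclideanSpace ℝ (Fin 4) := fun q => Le.symm (ψ q) with hΘ₀
  have hΘ₀c : ContinuousOn Θ₀ ψ.source := Le.symm.continuous.comp_continuousOn ψ.continuousOn
  set N : Set X := ψ.source ∩ Θ₀ ⁻¹' B with hN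
  have hNo : IsOpen N := hΘ₀c.isOpen_inter_preimage ψ.open_source hBo
  have hwN : e w ∈ N :=
    ⟨hsrc hwφ, by show Θ₀ (e w) ∈ B; rw [hΘ₀]; dsimp only; rw [(hΘe w hwφ).1]; exact hzB⟩
  have hNsub : N ⊆ range e := by
    rintro y ⟨hyψ, hyB⟩
    have hyt : Θ₀ y ∈ (φ.extend (𝓡∂ 4)).target := hBtgt hyB
    set w' := (φ.extend (𝓡∂ 4)).symm (Θ₀ y) with hw'
    have hw'src : w' ∈ φ.source := by
      have := (φ.extend (𝓡∂ 4)).map_target hyt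
      rwa [OpenPartialHomeomorph.extend_source] at this
    have h1 := hkey _ hyt
    have h2 : (φ.extend (𝓡∂ 4)).symm (Θ₀ y) = φ.symm ((𝓡∂ 4).symm (Θ₀ y)) := by
      rw [OpenPartialHomeomorph.extend_coe_symm]; rfl
    rw [← h2, ← hw'] at h1
    have h3 : ψ (e w') = ψ y := by
      rw [h1]; show Le (Le.symm (ψ y)) = ψ y; exact Le.apply_symm_apply _
    exact ⟨w', ψ.injOn (hsrc hw'src) hyψ h3⟩
  exact mem_interior.2 ⟨N, hNsub, hNo, hwN⟩

/-- **A point of the sector manifold whose image is interior to the sector is an interior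
point, for a boundary-adapted Morse function**: if `e w ∈ interior (range e)` and `e` is an
immersion at `w`, then `f w < 1` and `w` is an interior point (otherwise the ambient extension
of `f` near `e w`, `exists_contMDiffOn_extension_of_isImmersionAt`, would have a local maximum
`1` at the interior point `e w` of `X`, so `w` would be a critical boundary point of `f`).
[cite: MilnorHCobordism1965, Def. 3.1] -/
theorem apply_lt_one_of_mem_interior_range [T2Space X] [IsManifold (𝓡 4) ∞ X]
    [IsManifold (𝓡∂ 4) ∞ W] {e : W → X} (he : Topology.IsEmbedding e) {f : W → ℝ}
    (hf : IsMorseAdapted (𝓡∂ 4) f) {w : W} (himm : Manifold.IsImmersionAt (𝓡∂ 4) (𝓡 4) ∞ e w)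
    (hint : e w ∈ interior (range e)) : f w < 1 ∧ (𝓡∂ 4).IsInteriorPoint w := by
  have hfle : ∀ w', f w' ≤ 1 := by
    intro w'
    rcases (𝓡∂ 4).isInteriorPoint_or_isBoundaryPoint w' with hw' | hw'
    · exact (hf.2.2 w' hw').le
    · exact le_of_eq (hf.2.1 w' hw').1
  have key : f w < 1 := by
    by_contra hnot
    have hf1 : f w = 1 := le_antisymm (hfle w) (not_lt.1 hnot)
    -- the ambient extension has a local max at `e w`
    obtain ⟨N, F, hNo, hwN, hFs, hFf⟩ :=
      exists_contMDiffOn_extension_of_isImmersionAt he himm hf.isMorse.contMDiff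
    have hmax : IsLocalMax F (e w) := by
      have h1 : ∀ᶠ y in 𝓝 (e w), y ∈ interior (range e) ∩ N :=
        (isOpen_interior.inter hNo).mem_nhds ⟨hint, hwN⟩
      filter_upwards [h1] with y hy
      obtain ⟨w', rfl⟩ := interior_subset hy.1
      rw [hFf w' hy.2, hFf w hwN, hf1]
      exact hfle w'
    -- hence `e w` is a critical point of `F`, and `w` of `f`
    have hFsm : ContMDiffAt (𝓡 4) 𝓘(ℝ, ℝ) ∞ F (e w) := hFs.contMDiffAt (hNo.mem_nhds hwN)
    have hcritF : IsMCriticalPt (𝓡 4) F (e w) := by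
      have hψ := IsManifold.chart_mem_maximalAtlas (I := 𝓡 4) (n := 2) (e w)
      rw [isMCriticalPt_iff_fderiv_comp_extend_symm_eq_zero (hFsm.of_le ENat.LEInfty.out) hψ
        (mem_chart_source _ (e w))]
      -- `F ∘ chart⁻¹` has a local max at the chart point
      have hmax' : IsLocalMax (F ∘ ((chartAt (EuclideanSpace ℝ (Fin 4)) (e w)).extend (𝓡 4)).symm)
          ((chartAt (EuclideanSpace ℝ (Fin 4)) (e w)).extend (𝓡 4) (e w)) := by
        have hc : ContinuousAt ((chartAt (EuclideanSpace ℝ (Fin 4)) (e w)).extend (𝓡 4)).symm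
            ((chartAt (EuclideanSpace ℝ (Fin 4)) (e w)).extend (𝓡 4) (e w)) := by
          have := continuousAt_extChartAt_symm (I := 𝓡 4) (e w)
          simpa using this
        have hval : ((chartAt (EuclideanSpace ℝ (Fin 4)) (e w)).extend (𝓡 4)).symm
            ((chartAt (EuclideanSpace ℝ (Fin 4)) (e w)).extend (𝓡 4) (e w)) = e w := by
          simp
        have hmax'' : IsLocalMax F (((chartAt (EuclideanSpace ℝ (Fin 4)) (e w)).extend (𝓡 4)).symm
            ((chartAt (EuclideanSpace ℝ (Fin 4)) (e w)).extend (𝓡 4) (e w))) := by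
          rw [hval]; exact hmax
        exact IsLocalMax.comp_continuous hmax'' hc
      exact hmax'.fderiv_eq_zero
    have hcritf : IsMCriticalPt (𝓡∂ 4) f w := by
      by_contra hreg
      exact not_isMCriticalPt_of_comp_eventuallyEq (himm.contMDiffAt.mdifferentiableAt (by simp))
        (hFsm.mdifferentiableAt (by simp))
        (by
          have h1 : ∀ᶠ w' in 𝓝 w, e w' ∈ N :=
            himm.contMDiffAt.continuousAt.preimage_mem_nhds (hNo.mem_nhds hwN)
          filter_upwards [h1] with w' hw'
          exact hFf w' hw') hreg hcritF
    -- but `w` is a boundary point (`f w = 1`), hence regular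
    rcases (𝓡∂ 4).isInteriorPoint_or_isBoundaryPoint w with hw | hw
    · exact absurd hf1 (hf.2.2 w hw).ne
    · exact (hf.2.1 w hw).2 hcritf
  refine ⟨key, ?_⟩
  rcases (𝓡∂ 4).isInteriorPoint_or_isBoundaryPoint w with hw | hw
  · exact hw
  · exact absurd (hf.2.1 w hw).1 key.ne

/-- **The half-slice coordinate vanishes exactly at the non-interior points of the slice.**
For a half-slice chart `D` of `S` (`q ∈ S ↔ 0 ≤ (Θ q)₀` on the source) and `p ∈ S` in the
source: `0 < (Θ p)₀` iff `p` lies in the interior of `S` in `M` (the open set `{Θ₀ > 0}` lies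
in `S`; if `(Θ p)₀ = 0`, the points `Θ⁻¹(Θ p - t e₀)` leave `S` and tend to `p`). [folklore] -/
theorem HalfSliceChart.apply_zero_pos_iff_mem_interior {M : Type u} [TopologicalSpace M]
    [ChartedSpace (EuclideanSpace ℝ (Fin 4)) M] {S : Set M} (D : HalfSliceChart (𝓡 4) S)
    {p : M} (hp : p ∈ D.Θ.source) (hpS : p ∈ S) : 0 < D.Θ p 0 ↔ p ∈ interior S := by
  constructor
  · intro hpos
    have hopen : IsOpen (D.Θ.source ∩ D.Θ ⁻¹' {z | 0 < z 0}) :=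
      D.Θ.continuousOn.isOpen_inter_preimage D.Θ.open_source
        (isOpen_lt continuous_const (EuclideanSpace.proj (0 : Fin 4)).continuous)
    refine mem_interior.2 ⟨_, fun q hq => (D.mem_iff q hq.1).2 (le_of_lt hq.2), hopen, ⟨hp, hpos⟩⟩
  · intro hint
    by_contra hle
    have h0 : D.Θ p 0 = 0 := le_antisymm (not_lt.1 hle) ((D.mem_iff p hp).1 hpS)
    -- push `p` across the face
    set γ : ℝ → M := fun t => D.Θ.symm (D.Θ p - t • EuclideanSpace.single 0 (1:ℝ)) with hγ
    have hγc : Tendsto γ (𝓝[>] 0) (𝓝 p) := by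
      have h1 : Tendsto (fun t : ℝ => D.Θ p - t • EuclideanSpace.single (0 : Fin 4) (1:ℝ)) (𝓝 0)
          (𝓝 (D.Θ p)) := by
        have : Continuous fun t : ℝ => D.Θ p - t • EuclideanSpace.single (0 : Fin 4) (1:ℝ) := by
          fun_prop
        simpa using this.tendsto 0
      have h2 : ContinuousAt D.Θ.symm (D.Θ p) := D.Θ.continuousAt_symm (D.Θ.map_source hp)
      have h3 := h2.tendsto.comp h1
      rw [D.Θ.left_inv hp] at h3
      exact h3.mono_left nhdsWithin_le_nhds
    have htgt : ∀ᶠ t in 𝓝[>] (0:ℝ),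
        D.Θ p - t • EuclideanSpace.single (0 : Fin 4) (1:ℝ) ∈ D.Θ.target := by
      have h1 : Tendsto (fun t : ℝ => D.Θ p - t • EuclideanSpace.single (0 : Fin 4) (1:ℝ)) (𝓝 0)
          (𝓝 (D.Θ p)) := by
        have : Continuous fun t : ℝ => D.Θ p - t • EuclideanSpace.single (0 : Fin 4) (1:ℝ) := by
          fun_prop
        simpa using this.tendsto 0
      exact Filter.Eventually.filter_mono nhdsWithin_le_nhds
        (h1 (D.Θ.open_target.mem_nhds (D.Θ.map_source hp)))
    have hout : ∀ᶠ t in 𝓝[>] (0:ℝ), γ t ∉ S := by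
      filter_upwards [htgt, self_mem_nhdsWithin] with t ht htpos
      intro hS
      have hsrc : γ t ∈ D.Θ.source := D.Θ.map_target ht
      have := (D.mem_iff _ hsrc).1 hS
      rw [hγ] at this; dsimp only at this
      rw [D.Θ.right_inv ht] at this
      simp [h0] at this
      exact absurd this (not_le.2 (mem_Ioi.1 htpos))
    -- but `interior S` is a neighbourhood of `p`
    have hin : ∀ᶠ t in 𝓝[>] (0:ℝ), γ t ∈ interior S := hγc (isOpen_interior.mem_nhds hint)
    obtain ⟨t, ht1, ht2⟩ := (hout.and hin).exists
    exact ht1 (interior_subset ht2)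

end Boundary

section Cutoff

variable {X : Type u} [TopologicalSpace X] [T2Space X] [CompactSpace X]
  [ChartedSpace (EuclideanSpace ℝ (Fin 4)) X] [IsManifold (𝓡 4) ∞ X]

/-- The cutoff profile `χ₁ x = smoothTransition (2 - 2x)`: smooth, values in `[0, 1]`, `= 1` for
`x ≤ 1/2`, `= 0` for `x ≥ 1`, with bounded derivative. [folklore] -/
theorem cutoffProfile_props :
    ContDiff ℝ ∞ (fun x : ℝ => Real.smoothTransition (2 - 2 * x)) ∧
    (∀ x : ℝ, 0 ≤ Real.smoothTransition (2 - 2 * x) ∧ Real.smoothTransition (2 - 2 * x) ≤ 1) ∧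
    (∀ x : ℝ, x ≤ 1 / 2 → Real.smoothTransition (2 - 2 * x) = 1) ∧
    (∀ x : ℝ, 1 ≤ x → Real.smoothTransition (2 - 2 * x) = 0) ∧
    ∃ Cχ : ℝ, 0 ≤ Cχ ∧
      ∀ x : ℝ, |deriv (fun x : ℝ => Real.smoothTransition (2 - 2 * x)) x| ≤ Cχ := by
  have hsm : ContDiff ℝ ∞ (fun x : ℝ => Real.smoothTransition (2 - 2 * x)) :=
    Real.smoothTransition.contDiff.comp (contDiff_const.sub (contDiff_const.mul contDiff_id))
  refine ⟨hsm, fun x => ⟨Real.smoothTransition.nonneg _, Real.smoothTransition.le_one _⟩,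
    fun x hx => Real.smoothTransition.one_of_one_le (by linarith),
    fun x hx => Real.smoothTransition.zero_of_nonpos (by linarith), ?_⟩
  -- the derivative is continuous and vanishes outside `[1/2, 1]`, hence bounded
  set d : ℝ → ℝ := deriv fun x : ℝ => Real.smoothTransition (2 - 2 * x) with hd
  have hdc : Continuous d := (hsm.continuous_deriv (by simp))
  have hzero : ∀ x, x ∉ Icc (1/2 : ℝ) 1 → d x = 0 := by
    intro x hx
    rw [mem_Icc, not_and_or, not_le, not_le] at hx
    rcases hx with hx | hx
    · -- locally constant `= 1`
      have hev : (fun x : ℝ => Real.smoothTransition (2 - 2 * x)) =ᶠ[𝓝 x] fun _ => 1 := by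
        filter_upwards [Iio_mem_nhds hx] with y hy
        exact Real.smoothTransition.one_of_one_le (by simp only [mem_Iio] at hy; linarith)
      rw [hd, hev.deriv_eq]; simp
    · have hev : (fun x : ℝ => Real.smoothTransition (2 - 2 * x)) =ᶠ[𝓝 x] fun _ => 0 := by
        filter_upwards [Ioi_mem_nhds hx] with y hy
        exact Real.smoothTransition.zero_of_nonpos (by simp only [mem_Ioi] at hy; linarith)
      rw [hd, hev.deriv_eq]; simp
  obtain ⟨C, hC⟩ := isCompact_Icc.exists_bound_of_continuousOn (f := d) hdc.continuousOn
  refine ⟨max C 0, le_max_right _ _, fun x => ?_⟩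
  by_cases hx : x ∈ Icc (1/2 : ℝ) 1
  · exact (Real.norm_eq_abs _ ▸ hC x hx).trans (le_max_left _ _)
  · rw [hzero x hx, abs_zero]; exact le_max_right _ _

/-- **The cutoff localised at the central surface.**  Let `F ⊆ V` (`F` closed, `V` open) and
`u, v` smooth functions whose common zeros inside `V` lie in `F`.  There are an open `V₁` with
`F ⊆ V₁ ⊆ V` and `η₀ > 0` such that for every `0 < η ≤ η₀` the function
`χ = χ₁((u² + v²)/η)` on `V₁`, extended by `0`, is smooth on `X` (it is `β · χ₁((u² + v²)/η)`
for a smooth `β` equal to `1` near `V̄₁` and supported in `V`; on the support of `β` outside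
`V₁`, `u² + v² ≥ 2η₀ > η`, where `χ₁ = 0`).  Here `χ₁ x = smoothTransition (2 - 2x)`.
[folklore] -/
theorem exists_localised_cutoff {F V : Set X} (hF : IsClosed F) (hV : IsOpen V) (hFV : F ⊆ V)
    {u v : X → ℝ} (hu : ContMDiff (𝓡 4) 𝓘(ℝ, ℝ) ∞ u) (hv : ContMDiff (𝓡 4) 𝓘(ℝ, ℝ) ∞ v)
    (hzero : ∀ y ∈ V, u y = 0 → v y = 0 → y ∈ F) :
    ∃ (V₁ : Set X) (η₀ : ℝ), IsOpen V₁ ∧ F ⊆ V₁ ∧ closure V₁ ⊆ V ∧ 0 < η₀ ∧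
      ∀ η : ℝ, 0 < η → η ≤ η₀ → ∃ χ : X → ℝ, ContMDiff (𝓡 4) 𝓘(ℝ, ℝ) ∞ χ ∧
        (∀ y, 0 ≤ χ y ∧ χ y ≤ 1) ∧
        (∀ y ∈ V₁, χ y = Real.smoothTransition (2 - 2 * ((u y ^ 2 + v y ^ 2) / η))) ∧
        (∀ y ∉ V₁, χ y = 0) := by
  haveI : LocallyCompactSpace X := ChartedSpace.locallyCompactSpace (EuclideanSpace ℝ (Fin 4)) X
  obtain ⟨V₁, hV₁o, hFV₁, hclV₁, hV₁c⟩ :=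
    exists_open_between_and_isCompact_closure hF.isCompact hV hFV
  -- an intermediate open set `V'` and a smooth `β` with `β = 1` on `closure V₁`, `β = 0` off `V'`
  obtain ⟨V', hV'o, hV₁V', hclV', -⟩ := exists_open_between_and_isCompact_closure hV₁c hV hclV₁
  obtain ⟨β, hβ0, hβ1, hβ01⟩ := exists_contMDiffMap_zero_one_of_isClosed (I := 𝓡 4) (n := (⊤ : ℕ∞))
    hV'o.isClosed_compl isClosed_closure (disjoint_compl_left_iff.2 hV₁V')
  -- `u² + v²` is bounded below on the compact `tsupport β ∖ V₁`
  set r2 : X → ℝ := fun y => u y ^ 2 + v y ^ 2 with hr2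
  have hr2c : Continuous r2 := (hu.continuous.pow 2).add (hv.continuous.pow 2)
  set K₀ : Set X := tsupport β ∩ V₁ᶜ with hK₀
  have hK₀c : IsCompact K₀ := (isClosed_tsupport _).isCompact.inter_right hV₁o.isClosed_compl
  have htsupp : tsupport β ⊆ V := by
    have hsupp : Function.support (β : X → ℝ) ⊆ V' := by
      intro y hy
      by_contra hyV'
      exact hy (hβ0 hyV')
    exact (closure_mono hsupp).trans hclV'

  obtain ⟨c₀, hc₀, hc₀le⟩ : ∃ c₀ : ℝ, 0 < c₀ ∧ ∀ y ∈ K₀, c₀ ≤ r2 y := by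
    rcases K₀.eq_empty_or_nonempty with hK | hK
    · exact ⟨1, one_pos, fun y hy => by rw [hK] at hy; exact absurd hy (notMem_empty _)⟩
    · obtain ⟨y₀, hy₀, hmin⟩ := hK₀c.exists_isMinOn hK hr2c.continuousOn
      refine ⟨r2 y₀, ?_, fun y hy => hmin hy⟩
      have hy₀V : y₀ ∈ V := htsupp hy₀.1
      by_contra hle
      have h0 : r2 y₀ = 0 := le_antisymm (not_lt.1 hle) (by positivity)
      have hu0 : u y₀ = 0 := by
        have : u y₀ ^ 2 = 0 := by nlinarith [sq_nonneg (u y₀), sq_nonneg (v y₀), h0.le, h0.ge]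
        exact pow_eq_zero_iff (n := 2) (by norm_num) |>.1 this
      have hv0 : v y₀ = 0 := by
        have : v y₀ ^ 2 = 0 := by nlinarith [sq_nonneg (u y₀), sq_nonneg (v y₀), h0.le, h0.ge]
        exact pow_eq_zero_iff (n := 2) (by norm_num) |>.1 this
      exact hy₀.2 (hFV₁ (hzero y₀ hy₀V hu0 hv0))
  refine ⟨V₁, c₀ / 2, hV₁o, hFV₁, hclV₁, by linarith, fun η hη hηle => ?_⟩
  obtain ⟨hχ₁s, hχ₁01, hχ₁one, hχ₁zero, -⟩ := cutoffProfile_props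
  set χ : X → ℝ := fun y => β y * Real.smoothTransition (2 - 2 * (r2 y / η)) with hχ
  have hχs : ContMDiff (𝓡 4) 𝓘(ℝ, ℝ) ∞ χ := by
    have h1 : ContMDiff (𝓡 4) 𝓘(ℝ, ℝ) ∞ fun y => r2 y / η :=
      ((hu.pow 2).add (hv.pow 2)).div_const η
    have h2 : ContMDiff (𝓡 4) 𝓘(ℝ, ℝ) ∞ fun y => Real.smoothTransition (2 - 2 * (r2 y / η)) :=
      (contMDiff_iff_contDiff.2 hχ₁s).comp h1
    exact β.contMDiff.mul h2
  -- outside `V₁`, `χ = 0`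
  have hout : ∀ y ∉ V₁, χ y = 0 := by
    intro y hy
    by_cases hyβ : y ∈ tsupport β
    · have hr : c₀ ≤ r2 y := hc₀le y ⟨hyβ, hy⟩
      have : 1 ≤ r2 y / η := by rw [le_div_iff₀ hη]; linarith
      simp only [hχ, hχ₁zero _ this, mul_zero]
    · have : β y = 0 := image_eq_zero_of_notMem_tsupport hyβ
      simp only [hχ, this, zero_mul]
  refine ⟨χ, hχs, fun y => ?_, fun y hy => ?_, hout⟩
  · have hb := hβ01 y
    have hc := hχ₁01 (r2 y / η)
    exact ⟨mul_nonneg hb.1 hc.1, by nlinarith [hb.1, hb.2, hc.1, hc.2]⟩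
  · have : β y = 1 := hβ1 (subset_closure hy)
    simp only [hχ, this, one_mul, hr2]

end Cutoff

end Literature.Topology.FourManifolds
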